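import Mathlib
import Literature.MathematicalPhysics.QuantumFieldTheory.Balaban1983to89.B11Eq31V4Bound

/-!
# `Balaban1983to89.B14Eq366ActionF2` — [Balaban1988Convergent] (3.66) p. 283: the localized Wilson action is
`½Σ_{μ<ν} tr F²_{μν}(z)` + irrelevant terms (the term that cancels (3.61) by β′_j = β_j)

HONEST FRAMING (cell `lit-balaban`, verbatim): statement-level skeleton of published theorems with citation tags;
proofs where landed; nothing here is a claim about the Yang–Mills mass gap.

CITATION HEADER.  T. Bałaban, *Convergent renormalization expansions for lattice gauge theories*, Commun. Math.
Phys. **119** (1988) 243–285, doi:10.1007/bf01217741 [Balaban1988Convergent] (cell paper B14 = "[III]"; held text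
`paper:balaban1988-cmp119-convergent-renormalization`, journal page = PDF page + 242; (3.64)–(3.67) READ AS AN IMAGE
from the page render `b2b-balaban-ref1/pages/1988-cmp119-convergent-renormalization/…-p041-x2.png` (p. 283): the
OCR layer prints the coefficient of (3.66) as «−Σ», the render shows «½Σ»; A(φ, U) from p. 253 [PDF 11]).  Unit
`lit-balaban-r11` (reader/typer of B14), SKELETON row `B14.Eq3.65–3.66` (sub-display (3.66); (3.65) is
`B14.TentUnity.weightedAction_decomposition`, the tent functions h_z are `B14.TentUnity.tentD` /
`B14.TentUnityTorus.tentT` (3.40), the weighted action A(φ, U) is `B14Seam245.weightedAction` (p. 253), the field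
strength F_{μν} is (3.56) `B14.Eq356FieldStrength.fieldStrength`).  The four-exponential expansion is the tree's
[Balaban1985Variational] (34)–(35)/(31) machinery `B11Eq31V4Bound` (`grade4`, `norm_fourExp_sub_taylor_le`,
`sum_range_four_grade4`) and `B11Eq34BCH` (`Z1`, `comm2`, `prod2`, `bch4_degree2`), reused BY NAME.

WHAT IS PRINTED (p. 283 [PDF 41], verbatim up to typography).  *«Consider now the term −β_jA(φ_j, U_k). We decompose
it into the sum of localized expressions A(φ_j, U_k) = Σ_{z∈T^{(j)}} A(h_zφ_j, U_k), (3.65) where h_z is defined as in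
(3.40), but on the lattice T_{L^{−j}}, and with h(t) = max{1 − |t|, 0}. For z ∈ Λ_j⁰ we have h_zφ_j = h_z, and the
function A(h_z, U_j) is Euclidean covariant. Analyzing A(h_z, U_k) in the same way as above, we obtain
    A(h_z, U_k) = ½ Σ_{μ<ν} tr F²_{μν}(z) + (the irrelevant terms).   (3.66)
Thus the first expression on the right-hand side of the expansion of −β_jA(h_z, U_k) cancels the expression on the
right-hand side of (3.61), and we are left with the irrelevant terms only.»*  p. 253 [PDF 11]: *«The symbol A(φ₁, U₁)
means that we multiply the term in the Wilson action corresponding to a plaquette p by φ₁(x(p)), x(p) is the initial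
point of ∂p [i.e., p = p_{μν}(x) for some μ < ν].»*  So, in d = 4 on the lattice T_η, η = L^{−j} (Wilson action
`Σ_p η^{d−4}[1 − Re tr U(∂p)]`, tr normalized, [I] (0.2)):
`A(h_z, U) = Σ_{x∈T_η} h_z(x) Σ_{μ<ν} [1 − Re tr U(∂p_{μν}(x))]`.

THE COMPUTATION BEHIND (3.66) AND HOW IT IS FORMALIZED.  Write the small field as `U(x, x + ηe_μ) = exp iηB_μ(x)`.
Then `U(∂p_{μν}(x)) = e^{Y₁}e^{Y₂}e^{Y₃}e^{Y₄}` with `Y₁ = iηB_μ(x)`, `Y₂ = iηB_ν(x + ηe_μ)`, `Y₃ = −iηB_μ(x + ηe_ν)`,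
`Y₄ = −iηB_ν(x)` (`plaqHol`).  (§2) By [B11] (34)/(31): `Πe^{Yᵢ} = 1 + Z₁ + ½(Z₁² + C) + g₃ + R₄` with `Z₁ = ΣYᵢ`,
`C = Σ_{i<j}[Yᵢ, Yⱼ]`, `‖g₃‖ ≤ s³/3!`, `‖R₄‖ ≤ (s⁴/4!)eˢ`, `s = Σ‖Yᵢ‖`; a normalized trace kills `C` (commutators) and
`Re tr Z₁ = 0` (Z₁ = i × Hermitian), hence **`plaquette366`**:
`|[1 − Re tr Πe^{Yᵢ}] − ½ Re tr((Z₁/i)²)| ≤ s³/3` for `s ≤ 1` — the plaquette action IS the quadratic form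
`½ tr (Z₁/i)²` up to third order.  (§3) On the plaquette `Z₁/i = η²[(∂_μB_ν)(x) − (∂_νB_μ)(x)] =: η²D_{μν}(x)`
(forward lattice derivatives, `Z1_plaq`), and (3.56)'s `F_{μν}(x) = D_{μν}(x) + i[B_μ(x), B_ν(x)]` (`plaqF`;
the same expression as `B14.Eq356FieldStrength.fieldStrength` with `dB μ ν = (∂_μB_ν)(x)`), so
`½ Re tr (Z₁/i)² = ½η⁴ Re tr D²_{μν}(x)` (`plaquette366_abelian`) and
`|Re tr F² − Re tr D²| ≤ 2‖F‖‖[B_μ,B_ν]‖ + ‖[B_μ,B_ν]‖²` (`re_trace_F_sq_sub_D_sq`, cubic and quartic in the field),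
whence **`plaquette366_F`**: `|[1 − Re tr U(∂p_{μν}(x))] − ½η⁴ Re tr F²_{μν}(x)| ≤ s³/3 + η⁴(‖F‖‖[B_μ,B_ν]‖ +
½‖[B_μ,B_ν]‖²)` — «the irrelevant terms» of a single plaquette are of third order in the field, exactly as in
(3.69) «the third order terms are already irrelevant».  (§4) Summing with the weights h_z(x) ≥ 0 and relocating
F_{μν}(x) to F_{μν}(z): `A(h_z, U) = [Σ_x h_z(x)η⁴]·½Σ_{μ<ν} Re tr F²_{μν}(z) + Σ_x h_z(x)Σ_{μ<ν} r_{μν}(x)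
+ Σ_x h_z(x)η⁴ Σ_{μ<ν} ½[Re tr F²_{μν}(x) − Re tr F²_{μν}(z)]` (`eq366_decomposition`, exact), the middle sum bounded
by `Σ_x h_z(x)Σ_{μ<ν}|r_{μν}(x)|` (`eq366_remainder_le`); and (§5) the normalization that makes the coefficient
exactly ½: **`Σ_{x∈T_η} h_z(x) η⁴ = 1`** in d = 4 for `η = 1/N` (`tent_sum_1d`: `Σ_{|m|≤N−1}(N − |m|) = N²`, i.e.
`Σ_{m} h(m/N) = N`; `tent_sum_4d_normalized`: `N⁻⁴ Σ_{m∈{|mᵢ|<N}} Πᵢ h(mᵢ/N) = 1`), hence **`eq366`**: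
`A(h_z, U) = ½Σ_{μ<ν} Re tr F²_{μν}(z) + (the irrelevant terms)` with the irrelevant terms NAMED (third-order
plaquette remainders + relocation differences), the first bounded.

WHAT IS PROVED (kernel-checked, no `sorry`, standard axioms): everything below.  Definitions (with bodies):
`fwdDiff`, `plaqD`, `plaqComm`, `plaqF`, `plaqHol`, `tent1`.

WHAT IS NOT PROVED HERE (and not claimed): the identification of this file's abstract normalized trace `τ`
(tracial, `τ 1 = 1`, `|τ a| ≤ ‖a‖`, real on the Hermitian lattice derivatives) with the cell's `Setup.GaugeGroup.reTr`
(which carries no Lie-algebra/exponential structure); the smallness of the relocation differences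
`Re tr F²(x) − Re tr F²(z)` on the support of h_z (they are «irrelevant» by the decay (3.53)/(2.27) of ∂F, not
estimated here); the cancellation sentence itself beyond arithmetic (it is `β′_j = β_j`, (3.64),
`B14.Eq364Beta.eq364`, applied to the two ½Σ_{μ<ν} tr F² terms — recorded as `cancels_361`); the torus
bookkeeping of T_{L^{−j}} (the tent sum is done on the window {|mᵢ| < N} ⊂ ℤ⁴, which is the support of h_z).
NOT summit progress: one printed display of a proof, typed with its mechanism proved.
-/

namespace Literature.MathematicalPhysics.QuantumFieldTheory.Balaban1983to89.B14.Eq366ActionF2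

open NormedSpace Finset
open Complex (I)
open scoped Nat
open B11Eq34BCH (Z1 comm2 prod2 bch4_degree2)
open B11Eq31V4Bound (grade4 grade4_zero grade4_one two_smul_grade4_two norm_grade4_le
  norm_fourExp_sub_taylor_le)

/-! ## §1. The normalized trace: `tr` kills commutators, `Re tr` is bounded by the norm -/

section Trace

variable {𝔸 : Type*} [NormedRing 𝔸] [NormedAlgebra ℂ 𝔸]

/-- A tracial functional kills commutators: `tr [a, b] = 0`. [cite: Balaban1988Convergent, (3.66) p.283]
(elementary API: print's «tr») -/
theorem trace_lie_eq_zero (τ : 𝔸 →L[ℂ] ℂ) (htr : ∀ a b : 𝔸, τ (a * b) = τ (b * a)) (a b : 𝔸) :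
    τ ⁅a, b⁆ = 0 := by
  rw [Ring.lie_def, map_sub, htr, sub_self]

/-- Hence it kills [B11] (34)'s second-order commutator sum `C = Σ_{i<j}[Yᵢ, Yⱼ]`.
[cite: Balaban1988Convergent, (3.66) p.283] -/
theorem trace_comm2_eq_zero (τ : 𝔸 →L[ℂ] ℂ) (htr : ∀ a b : 𝔸, τ (a * b) = τ (b * a)) (Y₁ Y₂ Y₃ Y₄ : 𝔸) :
    τ (comm2 Y₁ Y₂ Y₃ Y₄) = 0 := by
  simp only [comm2, map_add, trace_lie_eq_zero τ htr, add_zero]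

/-- `Re tr (r·a) = r·Re tr a` for real `r`. [cite: Balaban1988Convergent, (3.66) p.283] (elementary API) -/
theorem re_trace_real_smul (τ : 𝔸 →L[ℂ] ℂ) (r : ℝ) (a : 𝔸) : (τ (r • a)).re = r * (τ a).re := by
  rw [← Complex.coe_smul, map_smul, smul_eq_mul, Complex.re_ofReal_mul]

/-- `|Re tr a| ≤ ‖a‖` when `|tr a| ≤ ‖a‖` (normalized trace vs operator norm).
[cite: Balaban1988Convergent, (3.66) p.283] (elementary API) -/
theorem abs_re_trace_le (τ : 𝔸 →L[ℂ] ℂ) (hτn : ∀ a : 𝔸, ‖τ a‖ ≤ ‖a‖) (a : 𝔸) : |(τ a).re| ≤ ‖a‖ :=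
  (Complex.abs_re_le_norm _).trans (hτn a)

end Trace

/-! ## §2. One plaquette, abstractly: `1 − Re tr Πe^{Yᵢ} = ½ Re tr (Z₁/i)² + O(s³)` -/

section FourFactors

variable {𝔸 : Type*} [NormedRing 𝔸] [NormedAlgebra ℂ 𝔸]

/-- `(Z/i)² = ((−i)Z)² = −Z²`. [cite: Balaban1988Convergent, (3.66) p.283] (elementary API) -/
theorem negI_smul_sq (Z : 𝔸) : ((-I) • Z) ^ 2 = -(Z * Z) := by
  rw [pow_two, smul_mul_assoc, mul_smul_comm, smul_smul,
    show (-I) * (-I) = (-1 : ℂ) by rw [neg_mul_neg, Complex.I_mul_I], neg_one_smul]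

variable [NormOneClass 𝔸] [CompleteSpace 𝔸]

/-- **(3.66) for one plaquette, «in the same way as above»** (i.e. as (3.49)/(3.69): expand in the field and keep
the quadratic term).  Let `τ` be print's normalized trace (tracial, `τ 1 = 1`, `|τ a| ≤ ‖a‖`) and `Y₁, …, Y₄` the
four bond exponents of `U(∂p) = e^{Y₁}e^{Y₂}e^{Y₃}e^{Y₄}` with `‖Yᵢ‖ ≤ uᵢ`, `s = Σuᵢ ≤ 1`, and `Re τ Z₁ = 0` for
`Z₁ = ΣYᵢ` (Z₁ = i × Hermitian).  Then
`|[1 − Re τ(e^{Y₁}e^{Y₂}e^{Y₃}e^{Y₄})] − ½ Re τ((Z₁/i)²)| ≤ s³/3`: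
by [B11] (34) `Πe^{Yᵢ} = 1 + Z₁ + ½(Z₁² + C) + g₃ + R₄`, `τ C = 0`, `‖g₃‖ ≤ s³/3!`, `‖R₄‖ ≤ (s⁴/4!)eˢ ≤ s³/8`.
[cite: Balaban1988Convergent, (3.66) p.283] -/
theorem plaquette366 (τ : 𝔸 →L[ℂ] ℂ) (htr : ∀ a b : 𝔸, τ (a * b) = τ (b * a)) (hτ1 : τ 1 = 1)
    (hτn : ∀ a : 𝔸, ‖τ a‖ ≤ ‖a‖) {Y₁ Y₂ Y₃ Y₄ : 𝔸} {u₁ u₂ u₃ u₄ : ℝ} (h₁ : ‖Y₁‖ ≤ u₁) (h₂ : ‖Y₂‖ ≤ u₂)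
    (h₃ : ‖Y₃‖ ≤ u₃) (h₄ : ‖Y₄‖ ≤ u₄) (hs : u₁ + u₂ + u₃ + u₄ ≤ 1) (hZ : (τ (Z1 Y₁ Y₂ Y₃ Y₄)).re = 0) :
    |(1 - (τ (exp Y₁ * exp Y₂ * exp Y₃ * exp Y₄)).re) - 2⁻¹ * (τ (((-I) • Z1 Y₁ Y₂ Y₃ Y₄) ^ 2)).re|
      ≤ (u₁ + u₂ + u₃ + u₄) ^ 3 / 3 := by
  have hu₁ : 0 ≤ u₁ := (norm_nonneg _).trans h₁
  have hu₂ : 0 ≤ u₂ := (norm_nonneg _).trans h₂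
  have hu₃ : 0 ≤ u₃ := (norm_nonneg _).trans h₃
  have hu₄ : 0 ≤ u₄ := (norm_nonneg _).trans h₄
  have hs0 : 0 ≤ u₁ + u₂ + u₃ + u₄ := by positivity
  -- the (34) decomposition of the product
  have hsum : ∑ N ∈ range 4, grade4 Y₁ Y₂ Y₃ Y₄ N
      = 1 + Z1 Y₁ Y₂ Y₃ Y₄ + grade4 Y₁ Y₂ Y₃ Y₄ 2 + grade4 Y₁ Y₂ Y₃ Y₄ 3 := by
    simp only [Finset.sum_range_succ, Finset.sum_range_zero, zero_add, grade4_zero, grade4_one]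
  have hg2 : grade4 Y₁ Y₂ Y₃ Y₄ 2 = (2 : ℝ)⁻¹ • (Z1 Y₁ Y₂ Y₃ Y₄ * Z1 Y₁ Y₂ Y₃ Y₄ + comm2 Y₁ Y₂ Y₃ Y₄) := by
    rw [← bch4_degree2, ← two_smul_grade4_two, inv_smul_smul₀ two_ne_zero]
  have hg3 : ‖grade4 Y₁ Y₂ Y₃ Y₄ 3‖ ≤ (u₁ + u₂ + u₃ + u₄) ^ 3 / 6 := by
    have h := norm_grade4_le h₁ h₂ h₃ h₄ 3
    have h6 : ((3 ! : ℕ) : ℝ) = 6 := by norm_num [Nat.factorial]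
    rwa [h6] at h
  have hR₄ : ‖exp Y₁ * exp Y₂ * exp Y₃ * exp Y₄
      - (1 + Z1 Y₁ Y₂ Y₃ Y₄ + grade4 Y₁ Y₂ Y₃ Y₄ 2 + grade4 Y₁ Y₂ Y₃ Y₄ 3)‖ ≤ (u₁ + u₂ + u₃ + u₄) ^ 3 / 8 := by
    rw [← hsum]
    refine (norm_fourExp_sub_taylor_le h₁ h₂ h₃ h₄).trans ?_
    have he : Real.exp (u₁ + u₂ + u₃ + u₄) ≤ 3 :=
      (Real.exp_le_exp.mpr hs).trans Real.exp_one_lt_three.le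
    have h24 : ((4 ! : ℕ) : ℝ) = 24 := by norm_num [Nat.factorial]
    have hp : (u₁ + u₂ + u₃ + u₄) ^ 4 ≤ (u₁ + u₂ + u₃ + u₄) ^ 3 :=
      pow_le_pow_of_le_one hs0 hs (by norm_num)
    rw [h24]
    calc (u₁ + u₂ + u₃ + u₄) ^ 4 / 24 * Real.exp (u₁ + u₂ + u₃ + u₄)
        ≤ (u₁ + u₂ + u₃ + u₄) ^ 3 / 24 * 3 :=
          mul_le_mul (div_le_div_of_nonneg_right hp (by norm_num)) he (Real.exp_pos _).le (by positivity)
      _ = (u₁ + u₂ + u₃ + u₄) ^ 3 / 8 := by ring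
  -- apply the trace
  have hdecomp : exp Y₁ * exp Y₂ * exp Y₃ * exp Y₄
      = 1 + Z1 Y₁ Y₂ Y₃ Y₄ + grade4 Y₁ Y₂ Y₃ Y₄ 2 + grade4 Y₁ Y₂ Y₃ Y₄ 3
        + (exp Y₁ * exp Y₂ * exp Y₃ * exp Y₄
            - (1 + Z1 Y₁ Y₂ Y₃ Y₄ + grade4 Y₁ Y₂ Y₃ Y₄ 2 + grade4 Y₁ Y₂ Y₃ Y₄ 3)) := by abel
  have hτg2 : (τ (grade4 Y₁ Y₂ Y₃ Y₄ 2)).re = 2⁻¹ * (τ (Z1 Y₁ Y₂ Y₃ Y₄ * Z1 Y₁ Y₂ Y₃ Y₄)).re := by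
    rw [hg2, re_trace_real_smul, map_add, trace_comm2_eq_zero τ htr, add_zero]
  have hτP : (τ (exp Y₁ * exp Y₂ * exp Y₃ * exp Y₄)).re
      = 1 + 2⁻¹ * (τ (Z1 Y₁ Y₂ Y₃ Y₄ * Z1 Y₁ Y₂ Y₃ Y₄)).re + (τ (grade4 Y₁ Y₂ Y₃ Y₄ 3)).re
        + (τ (exp Y₁ * exp Y₂ * exp Y₃ * exp Y₄
            - (1 + Z1 Y₁ Y₂ Y₃ Y₄ + grade4 Y₁ Y₂ Y₃ Y₄ 2 + grade4 Y₁ Y₂ Y₃ Y₄ 3))).re := by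
    conv_lhs => rw [hdecomp]
    simp only [map_add, Complex.add_re, hτ1, Complex.one_re, hZ, add_zero, hτg2]
  have hτsq : (τ (((-I) • Z1 Y₁ Y₂ Y₃ Y₄) ^ 2)).re = -(τ (Z1 Y₁ Y₂ Y₃ Y₄ * Z1 Y₁ Y₂ Y₃ Y₄)).re := by
    rw [negI_smul_sq, map_neg, Complex.neg_re]
  have hb3 : |(τ (grade4 Y₁ Y₂ Y₃ Y₄ 3)).re| ≤ (u₁ + u₂ + u₃ + u₄) ^ 3 / 6 :=
    (abs_re_trace_le τ hτn _).trans hg3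
  have hb4 : |(τ (exp Y₁ * exp Y₂ * exp Y₃ * exp Y₄
      - (1 + Z1 Y₁ Y₂ Y₃ Y₄ + grade4 Y₁ Y₂ Y₃ Y₄ 2 + grade4 Y₁ Y₂ Y₃ Y₄ 3))).re|
        ≤ (u₁ + u₂ + u₃ + u₄) ^ 3 / 8 :=
    (abs_re_trace_le τ hτn _).trans hR₄
  rw [hτP, hτsq]
  have hring : ∀ a g r : ℝ, (1 - (1 + 2⁻¹ * a + g + r)) - 2⁻¹ * (-a) = -(g + r) := fun a g r => by ring
  rw [hring, abs_neg]
  have hp3 : 0 ≤ (u₁ + u₂ + u₃ + u₄) ^ 3 := pow_nonneg hs0 3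
  calc _ ≤ |(τ (grade4 Y₁ Y₂ Y₃ Y₄ 3)).re| + |(τ (exp Y₁ * exp Y₂ * exp Y₃ * exp Y₄
          - (1 + Z1 Y₁ Y₂ Y₃ Y₄ + grade4 Y₁ Y₂ Y₃ Y₄ 2 + grade4 Y₁ Y₂ Y₃ Y₄ 3))).re| := abs_add_le _ _
    _ ≤ (u₁ + u₂ + u₃ + u₄) ^ 3 / 6 + (u₁ + u₂ + u₃ + u₄) ^ 3 / 8 := add_le_add hb3 hb4
    _ ≤ (u₁ + u₂ + u₃ + u₄) ^ 3 / 3 := by linarith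

end FourFactors

/-! ## §3. The plaquette `p_{μν}(x)` of the η-lattice: `Z₁/i = η²D_{μν}(x)`, `F_{μν}(x) = D_{μν}(x) + i[B_μ, B_ν](x)` -/

section Plaquette

variable {𝔸 : Type*} [NormedRing 𝔸] [NormedAlgebra ℂ 𝔸]

/-- The forward lattice derivative quotient on the η-lattice: `(∂f)(x) = (f(x + ηe) − f(x))/η`, from the two values
`f = f(x)`, `f' = f(x + ηe)`. [cite: Balaban1988Convergent, (3.56) p.281, (3.66) p.283] -/
noncomputable def fwdDiff (η : ℝ) (f f' : 𝔸) : 𝔸 := (η⁻¹ : ℝ) • (f' - f)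

/-- The abelian (derivative) part of the field strength at the plaquette `p_{μν}(x)`:
`D_{μν}(x) = (∂_μB_ν)(x) − (∂_νB_μ)(x)`, from the four bond values `bμ = B_μ(x)`, `bν = B_ν(x)`,
`bμ' = B_μ(x + ηe_ν)`, `bν' = B_ν(x + ηe_μ)`. [cite: Balaban1988Convergent, (3.56) p.281, (3.66) p.283] -/
noncomputable def plaqD (η : ℝ) (bμ bν bμ' bν' : 𝔸) : 𝔸 := fwdDiff η bν bν' - fwdDiff η bμ bμ'

/-- The commutator `[B_μ(x), B_ν(x)]`. [cite: Balaban1988Convergent, (3.56) p.281] -/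
def plaqComm (bμ bν : 𝔸) : 𝔸 := bμ * bν - bν * bμ

/-- **(3.56) on the η-lattice**: `F_{μν}(x) = (∂_μB_ν)(x) − (∂_νB_μ)(x) + i[B_μ(x), B_ν(x)]` — the same expression as
`B14.Eq356FieldStrength.fieldStrength dB B μ ν` with `dB μ ν = (∂_μB_ν)(x)` the forward lattice derivatives.
[cite: Balaban1988Convergent, (3.56) p.281, (3.66) p.283] -/
noncomputable def plaqF (η : ℝ) (bμ bν bμ' bν' : 𝔸) : 𝔸 := plaqD η bμ bν bμ' bν' + I • plaqComm bμ bν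

/-- The plaquette holonomy of the small field `U(x, x + ηe_μ) = exp iηB_μ(x)`:
`U(∂p_{μν}(x)) = e^{iηB_μ(x)} e^{iηB_ν(x+ηe_μ)} e^{−iηB_μ(x+ηe_ν)} e^{−iηB_ν(x)}`.
[cite: Balaban1988Convergent, (3.66) p.283] -/
noncomputable def plaqHol (η : ℝ) (bμ bν bμ' bν' : 𝔸) : 𝔸 :=
  exp ((I * η : ℂ) • bμ) * exp ((I * η : ℂ) • bν') * exp (-((I * η : ℂ) • bμ')) * exp (-((I * η : ℂ) • bν))

/-- `F_{μν}(x) − i[B_μ, B_ν](x) = D_{μν}(x)`. [cite: Balaban1988Convergent, (3.56) p.281] -/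
theorem plaqF_sub_comm (η : ℝ) (bμ bν bμ' bν' : 𝔸) :
    plaqF η bμ bν bμ' bν' - I • plaqComm bμ bν = plaqD η bμ bν bμ' bν' := by
  simp [plaqF]

/-- **The first-order BCH term of the plaquette is `iη²` times the lattice curl**:
`Z₁ = iη[B_μ(x) + B_ν(x + ηe_μ) − B_μ(x + ηe_ν) − B_ν(x)] = iη²[(∂_μB_ν)(x) − (∂_νB_μ)(x)]` (`η ≠ 0`).
[cite: Balaban1988Convergent, (3.66) p.283] -/
theorem Z1_plaq {η : ℝ} (hη : η ≠ 0) (bμ bν bμ' bν' : 𝔸) :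
    Z1 ((I * η : ℂ) • bμ) ((I * η : ℂ) • bν') (-((I * η : ℂ) • bμ')) (-((I * η : ℂ) • bν))
      = (I * η ^ 2 : ℂ) • plaqD η bμ bν bμ' bν' := by
  simp only [Z1, plaqD, fwdDiff, ← Complex.coe_smul, smul_sub, smul_smul]
  have hη' : (η : ℂ) ≠ 0 := Complex.ofReal_ne_zero.mpr hη
  have hc : (I * η ^ 2 : ℂ) * ((η⁻¹ : ℝ) : ℂ) = I * η := by
    push_cast
    rw [pow_two, mul_assoc, mul_assoc, mul_inv_cancel₀ hη', mul_one]
  rw [hc]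
  abel

/-- Hence `Z₁/i = η²D_{μν}(x)` (a real multiple of the Hermitian lattice curl).
[cite: Balaban1988Convergent, (3.66) p.283] -/
theorem negI_smul_Z1_plaq {η : ℝ} (hη : η ≠ 0) (bμ bν bμ' bν' : 𝔸) :
    (-I) • Z1 ((I * η : ℂ) • bμ) ((I * η : ℂ) • bν') (-((I * η : ℂ) • bμ')) (-((I * η : ℂ) • bν))
      = (η ^ 2 : ℝ) • plaqD η bμ bν bμ' bν' := by
  rw [Z1_plaq hη, smul_smul, ← Complex.coe_smul]
  congr 1
  push_cast
  rw [← mul_assoc, neg_mul, Complex.I_mul_I]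
  ring

/-- `Re τ Z₁ = 0` on the plaquette as soon as `τ` is real on the Hermitian lattice curl `D_{μν}(x)` (tr of a
Hermitian matrix is real): `τ Z₁ = iη²·τ D`. [cite: Balaban1988Convergent, (3.66) p.283] -/
theorem re_trace_Z1_plaq (τ : 𝔸 →L[ℂ] ℂ) {η : ℝ} (hη : η ≠ 0) (bμ bν bμ' bν' : 𝔸)
    (hreal : (τ (plaqD η bμ bν bμ' bν')).im = 0) :
    (τ (Z1 ((I * η : ℂ) • bμ) ((I * η : ℂ) • bν') (-((I * η : ℂ) • bμ')) (-((I * η : ℂ) • bν)))).re = 0 := by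
  rw [Z1_plaq hη, map_smul, smul_eq_mul, mul_assoc, Complex.I_mul_re]
  have : ((η : ℂ) ^ 2 * τ (plaqD η bμ bν bμ' bν')).im = 0 := by
    rw [show ((η : ℂ) ^ 2) = ((η ^ 2 : ℝ) : ℂ) by push_cast; ring, Complex.im_ofReal_mul, hreal, mul_zero]
  rw [this, neg_zero]

/-- **`F²` versus `D²`: the difference is cubic and quartic in the field.**  With `C = [B_μ, B_ν](x)`,
`D = F − iC`, `D² = F² − i(FC + CF) − C²`, so for `|τ a| ≤ ‖a‖`:
`|Re τ F² − Re τ D²| ≤ 2‖F‖‖C‖ + ‖C‖²`. [cite: Balaban1988Convergent, (3.66) p.283] -/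
theorem re_trace_F_sq_sub_D_sq (τ : 𝔸 →L[ℂ] ℂ) (hτn : ∀ a : 𝔸, ‖τ a‖ ≤ ‖a‖) (η : ℝ) (bμ bν bμ' bν' : 𝔸) :
    |(τ (plaqF η bμ bν bμ' bν' ^ 2)).re - (τ (plaqD η bμ bν bμ' bν' ^ 2)).re|
      ≤ 2 * ‖plaqF η bμ bν bμ' bν'‖ * ‖plaqComm bμ bν‖ + ‖plaqComm bμ bν‖ ^ 2 := by
  set F := plaqF η bμ bν bμ' bν'
  set C := plaqComm bμ bν
  have hD : plaqD η bμ bν bμ' bν' = F - I • C := (plaqF_sub_comm η bμ bν bμ' bν').symm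
  have hexp : (F - I • C) ^ 2 = F ^ 2 - I • (F * C + C * F) - C * C := by
    have hII : (I • C) * (I • C) = -(C * C) := by
      rw [smul_mul_assoc, mul_smul_comm, smul_smul, Complex.I_mul_I, neg_one_smul]
    rw [pow_two, pow_two, sub_mul, mul_sub, mul_sub, hII, mul_smul_comm, smul_mul_assoc, smul_add]
    abel
  rw [hD, hexp, map_sub, map_sub, Complex.sub_re, Complex.sub_re, map_smul, smul_eq_mul, Complex.I_mul_re]
  have h1 : |(τ (F * C + C * F)).im| ≤ 2 * ‖F‖ * ‖C‖ := by
    refine (Complex.abs_im_le_norm _).trans ((hτn _).trans ?_)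
    refine (norm_add_le _ _).trans ?_
    have := norm_mul_le F C
    have := norm_mul_le C F
    linarith
  have h2 : |(τ (C * C)).re| ≤ ‖C‖ ^ 2 := by
    refine (Complex.abs_re_le_norm _).trans ((hτn _).trans ?_)
    rw [pow_two]
    exact norm_mul_le C C
  have hring : ∀ a b c : ℝ, a - (a - -b - c) = -b + c := fun a b c => by ring
  rw [hring]
  calc |-(τ (F * C + C * F)).im + (τ (C * C)).re|
      ≤ |-(τ (F * C + C * F)).im| + |(τ (C * C)).re| := abs_add_le _ _
    _ = |(τ (F * C + C * F)).im| + |(τ (C * C)).re| := by rw [abs_neg]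
    _ ≤ 2 * ‖F‖ * ‖C‖ + ‖C‖ ^ 2 := add_le_add h1 h2

variable [NormOneClass 𝔸] [CompleteSpace 𝔸]

/-- **(3.66) for one plaquette, abelian form**: for `η > 0`, `s = η(‖B_μ(x)‖ + ‖B_ν(x+ηe_μ)‖ + ‖B_μ(x+ηe_ν)‖ +
‖B_ν(x)‖) ≤ 1` and `τ` real on the lattice curl,
`|[1 − Re τ U(∂p_{μν}(x))] − ½η⁴ Re τ D²_{μν}(x)| ≤ s³/3`. [cite: Balaban1988Convergent, (3.66) p.283] -/
theorem plaquette366_abelian (τ : 𝔸 →L[ℂ] ℂ) (htr : ∀ a b : 𝔸, τ (a * b) = τ (b * a)) (hτ1 : τ 1 = 1)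
    (hτn : ∀ a : 𝔸, ‖τ a‖ ≤ ‖a‖) {η : ℝ} (hη : 0 < η) (bμ bν bμ' bν' : 𝔸)
    (hs : η * (‖bμ‖ + ‖bν'‖ + ‖bμ'‖ + ‖bν‖) ≤ 1) (hreal : (τ (plaqD η bμ bν bμ' bν')).im = 0) :
    |(1 - (τ (plaqHol η bμ bν bμ' bν')).re) - 2⁻¹ * η ^ 4 * (τ (plaqD η bμ bν bμ' bν' ^ 2)).re|
      ≤ (η * (‖bμ‖ + ‖bν'‖ + ‖bμ'‖ + ‖bν‖)) ^ 3 / 3 := by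
  have hnY : ∀ b : 𝔸, ‖(I * η : ℂ) • b‖ = η * ‖b‖ := fun b => by
    rw [norm_smul, norm_mul, Complex.norm_I, one_mul, Complex.norm_real, Real.norm_of_nonneg hη.le]
  have hnY' : ∀ b : 𝔸, ‖-((I * η : ℂ) • b)‖ = η * ‖b‖ := fun b => by rw [norm_neg]; exact hnY b
  have hs' : η * ‖bμ‖ + η * ‖bν'‖ + η * ‖bμ'‖ + η * ‖bν‖ ≤ 1 := by
    have : η * ‖bμ‖ + η * ‖bν'‖ + η * ‖bμ'‖ + η * ‖bν‖ = η * (‖bμ‖ + ‖bν'‖ + ‖bμ'‖ + ‖bν‖) := by ring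
    rw [this]; exact hs
  have h := plaquette366 τ htr hτ1 hτn (hnY bμ).le (hnY bν').le (hnY' bμ').le (hnY' bν).le hs'
    (re_trace_Z1_plaq τ hη.ne' bμ bν bμ' bν' hreal)
  rw [negI_smul_Z1_plaq hη.ne', smul_pow, re_trace_real_smul] at h
  have hη4 : (η ^ 2) ^ 2 = η ^ 4 := by ring
  rw [hη4, ← mul_assoc] at h
  have hs3 : (η * ‖bμ‖ + η * ‖bν'‖ + η * ‖bμ'‖ + η * ‖bν‖) ^ 3 = (η * (‖bμ‖ + ‖bν'‖ + ‖bμ'‖ + ‖bν‖)) ^ 3 := by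
    ring
  rw [hs3] at h
  exact h

/-- **(3.66) for one plaquette, with the field strength (3.56)**: under the same hypotheses,
`|[1 − Re τ U(∂p_{μν}(x))] − ½η⁴ Re τ F²_{μν}(x)| ≤ s³/3 + η⁴(‖F_{μν}(x)‖‖[B_μ,B_ν](x)‖ + ½‖[B_μ,B_ν](x)‖²)` —
the plaquette term of the Wilson action IS `½η⁴ tr F²_{μν}(x)` up to terms of third and fourth order in the field
(«the irrelevant terms» of one plaquette). [cite: Balaban1988Convergent, (3.66) p.283] -/
theorem plaquette366_F (τ : 𝔸 →L[ℂ] ℂ) (htr : ∀ a b : 𝔸, τ (a * b) = τ (b * a)) (hτ1 : τ 1 = 1)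
    (hτn : ∀ a : 𝔸, ‖τ a‖ ≤ ‖a‖) {η : ℝ} (hη : 0 < η) (bμ bν bμ' bν' : 𝔸)
    (hs : η * (‖bμ‖ + ‖bν'‖ + ‖bμ'‖ + ‖bν‖) ≤ 1) (hreal : (τ (plaqD η bμ bν bμ' bν')).im = 0) :
    |(1 - (τ (plaqHol η bμ bν bμ' bν')).re) - 2⁻¹ * η ^ 4 * (τ (plaqF η bμ bν bμ' bν' ^ 2)).re|
      ≤ (η * (‖bμ‖ + ‖bν'‖ + ‖bμ'‖ + ‖bν‖)) ^ 3 / 3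
        + η ^ 4 * (‖plaqF η bμ bν bμ' bν'‖ * ‖plaqComm bμ bν‖ + 2⁻¹ * ‖plaqComm bμ bν‖ ^ 2) := by
  have hA := plaquette366_abelian τ htr hτ1 hτn hη bμ bν bμ' bν' hs hreal
  have hB := re_trace_F_sq_sub_D_sq τ hτn η bμ bν bμ' bν'
  have hη4 : 0 ≤ 2⁻¹ * η ^ 4 := by positivity
  have hB' : |2⁻¹ * η ^ 4 * (τ (plaqD η bμ bν bμ' bν' ^ 2)).re
      - 2⁻¹ * η ^ 4 * (τ (plaqF η bμ bν bμ' bν' ^ 2)).re|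
        ≤ 2⁻¹ * η ^ 4 * (2 * ‖plaqF η bμ bν bμ' bν'‖ * ‖plaqComm bμ bν‖ + ‖plaqComm bμ bν‖ ^ 2) := by
    rw [← mul_sub, abs_mul, abs_of_nonneg hη4, abs_sub_comm]
    exact mul_le_mul_of_nonneg_left hB hη4
  have hsplit : (1 - (τ (plaqHol η bμ bν bμ' bν')).re) - 2⁻¹ * η ^ 4 * (τ (plaqF η bμ bν bμ' bν' ^ 2)).re
      = ((1 - (τ (plaqHol η bμ bν bμ' bν')).re) - 2⁻¹ * η ^ 4 * (τ (plaqD η bμ bν bμ' bν' ^ 2)).re)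
        + (2⁻¹ * η ^ 4 * (τ (plaqD η bμ bν bμ' bν' ^ 2)).re
          - 2⁻¹ * η ^ 4 * (τ (plaqF η bμ bν bμ' bν' ^ 2)).re) := by ring
  rw [hsplit]
  refine (abs_add_le _ _).trans ?_
  refine (add_le_add hA hB').trans (le_of_eq ?_)
  ring

end Plaquette

/-! ## §4. (3.66): summing the plaquettes with the weights `h_z(x)` and relocating `F_{μν}(x)` to `z` -/

section Sum

variable {S Δ : Type*}

/-- **(3.66), exact decomposition of the localized action.**  For sites `x ∈ X` (a finite window carrying the
support of h_z), direction pairs `μ < ν` encoded by `d ∈ Δ`, weights `h x` (print: h_z(x)), plaquette actions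
`a x d = 1 − Re tr U(∂p_d(x))`, main terms `m x d = ½η⁴ Re tr F²_d(x)` and the values at the centre
`mz d = ½ Re tr F²_d(z)`:
`A(h_z, U) := Σ_x h(x) Σ_d a(x,d) = (Σ_x h(x)η⁴)·Σ_d mz(d) + Σ_x h(x) Σ_d [a(x,d) − m(x,d)]
  + Σ_x h(x) Σ_d [m(x,d) − η⁴ mz(d)]` — main term + third-order plaquette remainders + relocation differences.
[cite: Balaban1988Convergent, (3.65)-(3.66) p.283] -/
theorem eq366_decomposition (X : Finset S) (D : Finset Δ) (h : S → ℝ) (a m : S → Δ → ℝ) (mz : Δ → ℝ) (η : ℝ) :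
    ∑ x ∈ X, h x * ∑ d ∈ D, a x d
      = (∑ x ∈ X, h x * η ^ 4) * ∑ d ∈ D, mz d
        + ∑ x ∈ X, h x * ∑ d ∈ D, (a x d - m x d)
        + ∑ x ∈ X, h x * ∑ d ∈ D, (m x d - η ^ 4 * mz d) := by
  have hpt : ∀ x, h x * ∑ d ∈ D, a x d
      = h x * η ^ 4 * ∑ d ∈ D, mz d + h x * ∑ d ∈ D, (a x d - m x d)
        + h x * ∑ d ∈ D, (m x d - η ^ 4 * mz d) := by
    intro x
    rw [Finset.sum_sub_distrib, Finset.sum_sub_distrib, ← Finset.mul_sum]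
    ring
  rw [Finset.sum_congr rfl (fun x _ => hpt x), Finset.sum_add_distrib, Finset.sum_add_distrib, Finset.sum_mul]

/-- **The third-order plaquette remainders, summed**: if `|a(x,d) − m(x,d)| ≤ r(x,d)` (`plaquette366_F`) and
`h ≥ 0`, then `|Σ_x h(x) Σ_d [a(x,d) − m(x,d)]| ≤ Σ_x h(x) Σ_d r(x,d)`.
[cite: Balaban1988Convergent, (3.66) p.283] -/
theorem eq366_remainder_le (X : Finset S) (D : Finset Δ) (h : S → ℝ) (a m r : S → Δ → ℝ)
    (hh : ∀ x ∈ X, 0 ≤ h x) (hr : ∀ x ∈ X, ∀ d ∈ D, |a x d - m x d| ≤ r x d) :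
    |∑ x ∈ X, h x * ∑ d ∈ D, (a x d - m x d)| ≤ ∑ x ∈ X, h x * ∑ d ∈ D, r x d := by
  refine (Finset.abs_sum_le_sum_abs _ _).trans (Finset.sum_le_sum fun x hx => ?_)
  rw [abs_mul, abs_of_nonneg (hh x hx)]
  exact mul_le_mul_of_nonneg_left
    ((Finset.abs_sum_le_sum_abs _ _).trans (Finset.sum_le_sum fun d hd => hr x hx d hd)) (hh x hx)

/-- **(3.66)**, «A(h_z, U_k) = ½Σ_{μ<ν} tr F²_{μν}(z) + (the irrelevant terms)»: with the normalization
`Σ_x h_z(x)η⁴ = 1` of the tent weights in d = 4 (`tent_sum_4d_normalized`), the localized action is the centre term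
`Σ_d mz(d) = ½Σ_{μ<ν} Re tr F²_{μν}(z)` plus the two named irrelevant sums, the first of which is bounded by
`Σ_x h(x)Σ_d r(x,d)` (third order in the field). [cite: Balaban1988Convergent, (3.66) p.283] -/
theorem eq366 (X : Finset S) (D : Finset Δ) (h : S → ℝ) (a m r : S → Δ → ℝ) (mz : Δ → ℝ) {η : ℝ}
    (hnorm : ∑ x ∈ X, h x * η ^ 4 = 1) (hh : ∀ x ∈ X, 0 ≤ h x)
    (hr : ∀ x ∈ X, ∀ d ∈ D, |a x d - m x d| ≤ r x d) :
    |∑ x ∈ X, h x * ∑ d ∈ D, a x d - ∑ d ∈ D, mz d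
        - ∑ x ∈ X, h x * ∑ d ∈ D, (m x d - η ^ 4 * mz d)| ≤ ∑ x ∈ X, h x * ∑ d ∈ D, r x d := by
  rw [eq366_decomposition X D h a m mz η, hnorm, one_mul]
  have hring : ∀ p q u : ℝ, p + q + u - p - u = q := fun p q u => by ring
  rw [hring]
  exact eq366_remainder_le X D h a m r hh hr

/-- **«cancels the expression on the right-hand side of (3.61)»**: the (3.61) term `β′_j·½Σ_{μ<ν} tr F²(z)` and the
main term of `−β_jA(h_z, U_k)`, `−β_j·½Σ_{μ<ν} tr F²(z)`, sum to zero because `β′_j = β_j` ((3.64),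
`B14.Eq364Beta.eq364`). [cite: Balaban1988Convergent, (3.61) p.282, (3.64)-(3.66) p.283] -/
theorem cancels_361 {β β' Q : ℝ} (h364 : β' = β) : β' * Q + -(β * Q) = 0 := by
  rw [h364]; ring

end Sum

/-! ## §5. Why the coefficient is exactly ½: `Σ_{x∈T_η} h_z(x) η⁴ = 1` in d = 4 -/

section Tent

/-- The one-dimensional tent profile of (3.40)/(3.65) sampled on the lattice `(1/N)ℤ` and scaled by `N`:
`N·h(m/N) = N − |m|` for `|m| ≤ N` (`h(t) = max{1 − |t|, 0}`; outside `|m| < N` it vanishes).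
[cite: Balaban1988Convergent, (3.40) p.275, (3.65) p.283] -/
def tent1 (N : ℕ) (m : ℤ) : ℝ := (N : ℝ) - |(m : ℝ)|

/-- **The lattice tent sums to the inverse spacing**: `Σ_{|m| ≤ N−1} (N − |m|) = N²`, i.e.
`Σ_{m∈ℤ} h(m/N) = N` (`N ≥ 1`): the centre contributes N and the two slopes `2Σ_{j=1}^{N−1}(N − j) = N(N − 1)`.
Proved by induction in the form `Σ_{|m| ≤ N} (N + 1 − |m|) = (N + 1)²`.
[cite: Balaban1988Convergent, (3.65)-(3.66) p.283] -/
theorem tent_sum_1d (N : ℕ) : ∑ m ∈ Finset.Icc (-(N : ℤ)) N, tent1 (N + 1) m = ((N : ℝ) + 1) ^ 2 := by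
  induction N with
  | zero => simp [tent1]
  | succ N ih =>
    have hIcc : Finset.Icc (-((N + 1 : ℕ) : ℤ)) ((N + 1 : ℕ) : ℤ)
        = insert (-((N : ℤ) + 1)) (insert ((N : ℤ) + 1) (Finset.Icc (-(N : ℤ)) N)) := by
      ext m
      simp only [Finset.mem_Icc, Finset.mem_insert, Nat.cast_add, Nat.cast_one]
      omega
    have h1 : -((N : ℤ) + 1) ∉ insert ((N : ℤ) + 1) (Finset.Icc (-(N : ℤ)) N) := by
      simp only [Finset.mem_insert, Finset.mem_Icc]; omega
    have h2 : ((N : ℤ) + 1) ∉ Finset.Icc (-(N : ℤ)) N := by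
      simp only [Finset.mem_Icc]; omega
    rw [hIcc, Finset.sum_insert h1, Finset.sum_insert h2]
    -- the old window with the new height: each term grows by 1
    have hshift : ∑ m ∈ Finset.Icc (-(N : ℤ)) N, tent1 (N + 1 + 1) m
        = ∑ m ∈ Finset.Icc (-(N : ℤ)) N, tent1 (N + 1) m + ∑ m ∈ Finset.Icc (-(N : ℤ)) N, (1 : ℝ) := by
      rw [← Finset.sum_add_distrib]
      refine Finset.sum_congr rfl fun m _ => ?_
      simp only [tent1, Nat.cast_add, Nat.cast_one]
      ring
    have hcardN : (Finset.Icc (-(N : ℤ)) N).card = 2 * N + 1 := by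
      rw [Int.card_Icc]; omega
    have hcard : ∑ m ∈ Finset.Icc (-(N : ℤ)) N, (1 : ℝ) = 2 * N + 1 := by
      rw [Finset.sum_const, nsmul_eq_mul, mul_one, hcardN]
      norm_cast
    rw [hshift, ih, hcard]
    simp only [tent1, Nat.cast_add, Nat.cast_one, Int.cast_add, Int.cast_neg, Int.cast_natCast, Int.cast_one,
      abs_neg]
    rw [abs_of_nonneg (by positivity : (0 : ℝ) ≤ (N : ℝ) + 1)]
    ring

/-- The same in the form used on `T_{1/N}`: `Σ_{m=−N}^{N} h(m/(N+1))·… ` — explicitly, dividing by the height,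
`Σ_{|m| ≤ N} (1 − |m|/(N + 1)) = N + 1`. [cite: Balaban1988Convergent, (3.65)-(3.66) p.283] -/
theorem tent_sum_1d_normalized (N : ℕ) :
    ∑ m ∈ Finset.Icc (-(N : ℤ)) N, (1 - |(m : ℝ)| / ((N : ℝ) + 1)) = (N : ℝ) + 1 := by
  have hN : (0 : ℝ) < (N : ℝ) + 1 := by positivity
  have h := tent_sum_1d N
  have hterm : ∀ m : ℤ, (1 - |(m : ℝ)| / ((N : ℝ) + 1)) = ((N : ℝ) + 1)⁻¹ * tent1 (N + 1) m := fun m => by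
    simp only [tent1, Nat.cast_add, Nat.cast_one]
    rw [inv_mul_eq_div, sub_div, div_self hN.ne']
  simp_rw [hterm, ← Finset.mul_sum, h]
  rw [pow_two, ← mul_assoc, inv_mul_cancel₀ hN.ne', one_mul]

/-- **d = 4 normalization of (3.66)**: on the window `{|mᵢ| ≤ N}⁴ ⊂ ℤ⁴` (the support of h_z on `T_{1/(N+1)}`, centre
z = 0), `η⁴ Σ_x h_z(x) = (N + 1)⁻⁴ Σ_{m} Πᵢ (1 − |mᵢ|/(N + 1)) = 1` — so the weighted plaquette sum
`Σ_x h_z(x)·½η⁴ tr F²(z)` is exactly `½ tr F²(z)`, the coefficient printed in (3.66).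
[cite: Balaban1988Convergent, (3.65)-(3.66) p.283] -/
theorem tent_sum_4d_normalized (N : ℕ) :
    (((N : ℝ) + 1) ^ 4)⁻¹ * ∑ m ∈ Fintype.piFinset (fun _ : Fin 4 => Finset.Icc (-(N : ℤ)) N),
        ∏ i, (1 - |(m i : ℝ)| / ((N : ℝ) + 1)) = 1 := by
  have h4 : ∑ m ∈ Fintype.piFinset (fun _ : Fin 4 => Finset.Icc (-(N : ℤ)) N),
      ∏ i, (1 - |(m i : ℝ)| / ((N : ℝ) + 1))
        = (∑ m ∈ Finset.Icc (-(N : ℤ)) N, (1 - |(m : ℝ)| / ((N : ℝ) + 1))) ^ 4 :=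
    (Finset.sum_pow' (Finset.Icc (-(N : ℤ)) N) (fun m : ℤ => 1 - |(m : ℝ)| / ((N : ℝ) + 1)) 4).symm
  rw [h4, tent_sum_1d_normalized N]
  have hN : ((N : ℝ) + 1) ^ 4 ≠ 0 := by positivity
  exact inv_mul_cancel₀ hN

end Tent

end Literature.MathematicalPhysics.QuantumFieldTheory.Balaban1983to89.B14.Eq366ActionF2
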